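import Summits.MatrixMultiplication.MatrixMultiplication.Theorems.FarEdgeDescentVirtualAdditivity
import Summits.MatrixMultiplication.MatrixMultiplication.Theorems.FarEdgeDescentTower
import Literature.Computability.AlgebraicComplexity.BorderRankFlattening
import Literature.Computability.AlgebraicComplexity.LaserValueCertificate
import Literature.Computability.AlgebraicComplexity.BorderRankRestriction
import HarnessLib

/-!
# Route `FarEdgeDescent` — the full-class tower step (kernel XXIX)

decomp-mm ROOT cell (D-0178), lens 2 «structural dichotomy: special vs generic», gen 51.  THESES-FREE and
definition-free.  The TENSOR LAYER of the full-class anchored tower, stated once for an ARBITRARY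
sub-family of words so that the remaining work (cell memo NODE-g51, kernel XXX) is pure counting and real
analysis:

* §1 `algBorderRank_subwords_le` — for `D = ⊕ᵢ ⟨kᵢ,mᵢ,nᵢ⟩` with `bR(D) ≤ r` and any injective family
  `φ` of words of length `N`, the direct sum `W_φ` of the word blocks `⟨∏k, ∏m, ∏n⟩` has `bR(W_φ) ≤ r^N`
  (words restriction `tensorRestrictsTo_kroneckerPow_matMulDirectSum_words`, sub-family
  `tensorRestrictsTo_matMulDirectSum_reindex`, `bR(D^{⊗N}) ≤ bR(D)^N`).
* §2 `towerStep_of_le` — the CRUDE augmentation on top of any certified family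
  (Knuth Ex. 4.6.4‑67(g) crude form = tree `algBorderRank_cons_inner_le_of_le`, with the side condition
  discharged by the flattening bound `∑ mn ≤ bR`): `bR(⟨1, R − ∑mn, 1⟩ ⊕ W) ≤ R + ∑ km`.
* §3 the DROP-ONE enumeration of the words of length `N` other than a given word `w₀`
  (`Fin.succAbove`, injective), its counting identity
  `f(w₀-word) + ∑_{kept} ∏ⱼ f(letterⱼ) = (∑ᵢ fᵢ)^N` (`sum_dropOne_words_add`; legs with `f = k·m`, virtual
  values with `f = a^s B^t`), and `∏ k ≥ 2` on every kept word when `w₀` is the all-anchor word and every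
  other letter has `k ≥ 2` (`two_le_prod_of_ne_anchorWord`).
* §4 `towerStage` — ONE FULL STAGE of the crude full-class tower: from `bR(D) ≤ r` to the certificate
  `bR(⟨1, r^N − Y', 1⟩ ⊕ W⁻) ≤ r^N + X'` for the direct sum `W⁻` of ALL words of length `N` except the
  all-anchor word, AND the virtual readout `∑_{kept} (∏a)^s (∏B)^t ≤ r^N` at every sub-tangent point of
  `ω(1,·,1)` (kernel XXVIII), for symmetric words `⟨a,B,a⟩`.
Dropping the all-anchor word before augmenting is essential (cell instrument `sweep2.py`: charging its leg
kills the rate); reading the kept words against `r^N` rather than the new `r^N + X'` is free.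
NO definitions (gate rule D-0009).
[cite: KnuthTAOCP2, §4.6.4, Ex. 67(e),(g)] [cite: Blaser2013, Thm. 7.5 (proof), Lemma 7.1(2)]
[cite: LottiRomani1983, Prop. 3.3] [cite: Pan1984, §16–17] [cite: CoppersmithWinograd1982, Thm. 1]
-/

set_option linter.dupNamespace false

noncomputable section

open scoped BigOperators

namespace Summit.MatrixMultiplication.MatrixMultiplication.Theorems.FarEdgeDescentTowerStep

open Literature.Computability.AlgebraicComplexity
open Summit.MatrixMultiplication.MatrixMultiplication.Theorems.FarEdgeDescentVirtualPoint
open Summit.MatrixMultiplication.MatrixMultiplication.Theorems.FarEdgeDescentVirtualAdditivity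
open Summit.MatrixMultiplication.MatrixMultiplication.Theorems.FarEdgeDescentTower

variable (K : Type) [Field K] {p : ℕ} (k m n : Fin p → ℕ)

/-! ## §1 Sub-families of words of a certified direct sum -/

/-- **Words sub-family restriction**: for injective `φ : Fin p' → [p]^N` (coded in `Fin (p^N)`),
`D^{⊗N} ≥ ⊕_w ⟨∏ⱼ k_{φ(w)ⱼ}, ∏ⱼ m_{φ(w)ⱼ}, ∏ⱼ n_{φ(w)ⱼ}⟩`. [cite: Blaser2013, Thm. 7.5 (proof)] -/
theorem tensorRestrictsTo_kroneckerPow_subwords (N : ℕ) {p' : ℕ} (φ : Fin p' → Fin (p ^ N))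
    (hφ : Function.Injective φ) :
    TensorRestrictsTo (kroneckerPow (matMulDirectSum K k m n) N)
      (matMulDirectSum K (fun w => ∏ j, k (finFunctionFinEquiv.symm (φ w) j))
        (fun w => ∏ j, m (finFunctionFinEquiv.symm (φ w) j))
        (fun w => ∏ j, n (finFunctionFinEquiv.symm (φ w) j))) :=
  (tensorRestrictsTo_kroneckerPow_matMulDirectSum_words K k m n N).trans
    (tensorRestrictsTo_matMulDirectSum_reindex K
      (fun w : Fin (p ^ N) => ∏ j, k (finFunctionFinEquiv.symm w j))
      (fun w => ∏ j, m (finFunctionFinEquiv.symm w j))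
      (fun w => ∏ j, n (finFunctionFinEquiv.symm w j)) φ hφ)

/-- **`bR(W_φ) ≤ r^N`** for every sub-family of words of a direct sum with `bR(D) ≤ r`.
[cite: Blaser2013, Thm. 7.5 (proof)] [cite: ConnerGesmundoLandsbergVentura2022, §1.1] -/
theorem algBorderRank_subwords_le (N : ℕ) {p' : ℕ} (φ : Fin p' → Fin (p ^ N))
    (hφ : Function.Injective φ) {r : ℕ} (hr : algBorderRank (matMulDirectSum K k m n) ≤ r) :
    algBorderRank (matMulDirectSum K (fun w => ∏ j, k (finFunctionFinEquiv.symm (φ w) j))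
        (fun w => ∏ j, m (finFunctionFinEquiv.symm (φ w) j))
        (fun w => ∏ j, n (finFunctionFinEquiv.symm (φ w) j))) ≤ r ^ N := by
  classical
  exact (tensorRestrictsTo_kroneckerPow_subwords K k m n N φ hφ).algBorderRank_le.trans
    ((algBorderRank_kroneckerPow_le _ N).trans (Nat.pow_le_pow_left hr N))

/-! ## §2 The crude augmentation on top of a certified family -/

/-- **Crude step from any certificate** `bR(⊕_w ⟨k_w,m_w,n_w⟩) ≤ R` (all `k_w ≥ 1`):
`bR(⟨1, R − ∑ m_w n_w, 1⟩ ⊕ ⊕_w ⟨k_w,m_w,n_w⟩) ≤ R + ∑ k_w m_w` (the flattening bound `∑ mn ≤ bR ≤ R`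
discharges the side condition `q + ∑ mn ≤ R`). [cite: KnuthTAOCP2, §4.6.4, Ex. 67(e),(g)]
[cite: Blaser2013, Lemma 7.1(2)] -/
theorem towerStep_of_le {p' : ℕ} (kw mw nw : Fin p' → ℕ) (hk : ∀ w, 1 ≤ kw w) {R : ℕ}
    (hW : algBorderRank (matMulDirectSum K kw mw nw) ≤ R) :
    algBorderRank (matMulDirectSum K (Fin.cons 1 kw) (Fin.cons (R - ∑ w, mw w * nw w) mw)
        (Fin.cons 1 nw)) ≤ R + ∑ w, kw w * mw w := by
  have hY : ∑ w, mw w * nw w ≤ R :=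
    (sum_mul_le_algBorderRank_matMulDirectSum_right K kw mw nw hk).trans hW
  exact algBorderRank_cons_inner_le_of_le K kw mw nw hW (by omega)

/-! ## §3 The drop-one enumeration of words and its counting identities -/

/-- The enumeration `w ↦ w₀.succAbove w` of the words of length `N` other than `w₀` (coded in
`Fin (p^N) = Fin (M+1)`) is injective. [folklore] -/
theorem dropOne_injective {N M : ℕ} (hM : p ^ N = M + 1) (w₀ : Fin (M + 1)) :
    Function.Injective (fun w : Fin M => Fin.cast hM.symm (w₀.succAbove w)) :=
  (Fin.cast_injective _).comp Fin.succAbove_right_injective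

/-- A kept word is not `w₀`: as functions `Fin N → Fin p` they differ. [folklore] -/
theorem dropOne_ne {N M : ℕ} (hM : p ^ N = M + 1) (w₀ : Fin (M + 1)) (w : Fin M) :
    (finFunctionFinEquiv.symm (Fin.cast hM.symm (w₀.succAbove w)) : Fin N → Fin p) ≠
      finFunctionFinEquiv.symm (Fin.cast hM.symm w₀) := by
  intro h
  have h1 := finFunctionFinEquiv.symm.injective h
  have h2 : w₀.succAbove w = w₀ := Fin.cast_injective _ h1
  exact Fin.succAbove_ne w₀ w h2

/-- **Counting identity of the drop-one enumeration**: `∏ⱼ f(w₀ⱼ) + ∑_{w ≠ w₀} ∏ⱼ f(wⱼ) = (∑ᵢ fᵢ)^N`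
(any commutative semiring: legs with `f = k·m`, virtual values with `f = a^s B^t`). [folklore] -/
theorem sum_dropOne_words_add {S : Type*} [CommSemiring S] (f : Fin p → S) {N M : ℕ}
    (hM : p ^ N = M + 1) (w₀ : Fin (M + 1)) :
    (∏ j, f (finFunctionFinEquiv.symm (Fin.cast hM.symm w₀) j)) +
        ∑ w : Fin M, ∏ j, f (finFunctionFinEquiv.symm (Fin.cast hM.symm (w₀.succAbove w)) j) =
      (∑ i, f i) ^ N := by
  rw [← sum_words_prod f N]
  set g : Fin (p ^ N) → S := fun v => ∏ j, f (finFunctionFinEquiv.symm v j) with hg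
  have h1 : (∑ v : Fin (M + 1), g (Fin.cast hM.symm v)) =
      g (Fin.cast hM.symm w₀) + ∑ w : Fin M, g (Fin.cast hM.symm (w₀.succAbove w)) :=
    Fin.sum_univ_succAbove _ w₀
  have h2 : (∑ v : Fin (M + 1), g (Fin.cast hM.symm v)) = ∑ v : Fin (p ^ N), g v :=
    Fintype.sum_equiv (finCongr hM.symm) _ _ (fun v => rfl)
  rw [← h2, h1]

/-- **The all-anchor word**: for `w₀ = (i₀,…,i₀)` the `w₀`-term is `f(i₀)^N`. [folklore] -/
theorem prod_anchorWord {S : Type*} [CommSemiring S] (f : Fin p → S) {N M : ℕ}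
    (hM : p ^ N = M + 1) (i₀ : Fin p) :
    (∏ j, f (finFunctionFinEquiv.symm
        (Fin.cast hM.symm (Fin.cast hM (finFunctionFinEquiv (fun _ : Fin N => i₀)))) j)) =
      f i₀ ^ N := by
  have h : Fin.cast hM.symm (Fin.cast hM (finFunctionFinEquiv (fun _ : Fin N => i₀))) =
      finFunctionFinEquiv (fun _ : Fin N => i₀) := Fin.ext rfl
  rw [h, Equiv.symm_apply_apply, Finset.prod_const, Finset.card_univ, Fintype.card_fin]

/-- **Counting identity for the drop-anchor enumeration**: with `w₀` the all-`i₀` word,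
`f(i₀)^N + ∑_{kept words} ∏ⱼ f(letterⱼ) = (∑ᵢ fᵢ)^N`. [folklore] -/
theorem sum_dropAnchor_words_add {S : Type*} [CommSemiring S] (f : Fin p → S) {N M : ℕ}
    (hM : p ^ N = M + 1) (i₀ : Fin p) :
    f i₀ ^ N + ∑ w : Fin M, ∏ j, f (finFunctionFinEquiv.symm (Fin.cast hM.symm
        ((Fin.cast hM (finFunctionFinEquiv (fun _ : Fin N => i₀))).succAbove w)) j) =
      (∑ i, f i) ^ N := by
  rw [← prod_anchorWord f hM i₀]
  exact sum_dropOne_words_add f hM _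

/-- **Kept words contain a non-anchor letter**: if all `k i ≥ 1` and every letter `i ≠ i₀` has
`k i ≥ 2`, then every word other than the all-`i₀` word has `∏ⱼ k ≥ 2`. [folklore] -/
theorem two_le_prod_of_ne_anchorWord (hk1 : ∀ i, 1 ≤ k i) {i₀ : Fin p} (hk2 : ∀ i, i ≠ i₀ → 2 ≤ k i)
    {N : ℕ} {τ : Fin N → Fin p} (hτ : τ ≠ fun _ => i₀) : 2 ≤ ∏ j, k (τ j) := by
  obtain ⟨j, hj⟩ : ∃ j, τ j ≠ i₀ := Function.ne_iff.1 hτ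
  have hpos : 0 < ∏ j, k (τ j) := Finset.prod_pos fun j _ => hk1 (τ j)
  exact (hk2 _ hj).trans (Nat.le_of_dvd hpos (Finset.dvd_prod_of_mem _ (Finset.mem_univ j)))

/-- The kept words of the drop-anchor enumeration have `∏ k ≥ 2`. [folklore] -/
theorem two_le_prod_dropAnchor (hk1 : ∀ i, 1 ≤ k i) {i₀ : Fin p} (hk2 : ∀ i, i ≠ i₀ → 2 ≤ k i)
    {N M : ℕ} (hM : p ^ N = M + 1) (w : Fin M) :
    2 ≤ ∏ j, k (finFunctionFinEquiv.symm (Fin.cast hM.symm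
        ((Fin.cast hM (finFunctionFinEquiv (fun _ : Fin N => i₀))).succAbove w)) j) := by
  refine two_le_prod_of_ne_anchorWord k hk1 hk2 ?_
  have h := dropOne_ne hM (Fin.cast hM (finFunctionFinEquiv (fun _ : Fin N => i₀))) w
  have h0 : finFunctionFinEquiv.symm (Fin.cast hM.symm
      (Fin.cast hM (finFunctionFinEquiv (fun _ : Fin N => i₀)))) = fun _ : Fin N => i₀ := by
    have : Fin.cast hM.symm (Fin.cast hM (finFunctionFinEquiv (fun _ : Fin N => i₀))) =
        finFunctionFinEquiv (fun _ : Fin N => i₀) := Fin.ext rfl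
    rw [this, Equiv.symm_apply_apply]
  rwa [h0] at h

/-- Every word has `∏ B ≥ 1` when all `B ≥ 1`. [folklore] -/
theorem one_le_prod_word {B : Fin p → ℕ} (hB : ∀ i, 1 ≤ B i) {N : ℕ} (τ : Fin N → Fin p) :
    1 ≤ ∏ j, B (τ j) :=
  Nat.one_le_iff_ne_zero.2 (Finset.prod_pos fun j _ => hB (τ j)).ne'

/-! ## §4 One full stage of the crude full-class tower (symmetric words) -/

/-- **ONE FULL STAGE.**  Let `D = ⊕ᵢ ⟨aᵢ,Bᵢ,aᵢ⟩` (`p` symmetric far-edge words, among them possibly an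
anchor `i₀` with `a_{i₀} = 1`; all `aᵢ ≥ 1`, `Bᵢ ≥ 1`, and `aᵢ ≥ 2` for `i ≠ i₀`) carry a certificate
`bR(D) ≤ r`, and let `W⁻` be the direct sum of the blocks of ALL words of length `N` except the all-anchor
word (`p^N = M+1` words, `M` kept).  Then
(i) CERTIFICATE: `bR(⟨1, r^N − Y', 1⟩ ⊕ W⁻) ≤ r^N + X'` with `X' = Y' = ∑_{kept} (∏a)(∏B)` (crude
augmentation, one-leg cost);
(ii) READOUT: at every sub-tangent point `(s,t)` of `ω(1,·,1)`, `∑_{kept} (∏a)^s (∏B)^t ≤ r^N`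
(kernel XXVIII on `W⁻ ≤ D^{⊗N}`).
The new family is again of the same shape (anchor first, all other words with `∏a ≥ 2`), so the stage
iterates; the legs and virtual values of the kept words are `(∑ aB)^N − (a_{i₀}B_{i₀})^N` and
`(∑ a^s B^t)^N − (a_{i₀}^s B_{i₀}^t)^N` (`sum_dropAnchor_words_add`).
[cite: KnuthTAOCP2, §4.6.4, Ex. 67(g)] [cite: Blaser2013, Thm. 7.5 (proof)] [cite: Pan1984, §17] -/
theorem towerStage (a B : Fin p → ℕ) (ha1 : ∀ i, 1 ≤ a i) (hB : ∀ i, 1 ≤ B i) {i₀ : Fin p}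
    (ha2 : ∀ i, i ≠ i₀ → 2 ≤ a i) {r : ℕ} (hr : algBorderRank (matMulDirectSum K a B a) ≤ r)
    {N M : ℕ} (hM : p ^ N = M + 1) :
    (algBorderRank (matMulDirectSum K
        (Fin.cons 1 (fun w : Fin M => ∏ j, a (finFunctionFinEquiv.symm (Fin.cast hM.symm
          ((Fin.cast hM (finFunctionFinEquiv (fun _ : Fin N => i₀))).succAbove w)) j)))
        (Fin.cons (r ^ N - ∑ w : Fin M,
            (∏ j, B (finFunctionFinEquiv.symm (Fin.cast hM.symm
              ((Fin.cast hM (finFunctionFinEquiv (fun _ : Fin N => i₀))).succAbove w)) j)) *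
            (∏ j, a (finFunctionFinEquiv.symm (Fin.cast hM.symm
              ((Fin.cast hM (finFunctionFinEquiv (fun _ : Fin N => i₀))).succAbove w)) j)))
          (fun w : Fin M => ∏ j, B (finFunctionFinEquiv.symm (Fin.cast hM.symm
            ((Fin.cast hM (finFunctionFinEquiv (fun _ : Fin N => i₀))).succAbove w)) j)))
        (Fin.cons 1 (fun w : Fin M => ∏ j, a (finFunctionFinEquiv.symm (Fin.cast hM.symm
          ((Fin.cast hM (finFunctionFinEquiv (fun _ : Fin N => i₀))).succAbove w)) j)))) ≤
      r ^ N + ∑ w : Fin M,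
        (∏ j, a (finFunctionFinEquiv.symm (Fin.cast hM.symm
          ((Fin.cast hM (finFunctionFinEquiv (fun _ : Fin N => i₀))).succAbove w)) j)) *
        (∏ j, B (finFunctionFinEquiv.symm (Fin.cast hM.symm
          ((Fin.cast hM (finFunctionFinEquiv (fun _ : Fin N => i₀))).succAbove w)) j))) ∧
    (∀ s t : ℝ, (∀ y : ℝ, 0 ≤ y → s + y * t ≤ omegaRect K 1 y 1) →
      ∑ w : Fin M,
        (((∏ j, a (finFunctionFinEquiv.symm (Fin.cast hM.symm
          ((Fin.cast hM (finFunctionFinEquiv (fun _ : Fin N => i₀))).succAbove w)) j) : ℕ) : ℝ)) ^ s *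
        (((∏ j, B (finFunctionFinEquiv.symm (Fin.cast hM.symm
          ((Fin.cast hM (finFunctionFinEquiv (fun _ : Fin N => i₀))).succAbove w)) j) : ℕ) : ℝ)) ^ t
        ≤ (r : ℝ) ^ N) := by
  classical
  have hφ := dropOne_injective hM (Fin.cast hM (finFunctionFinEquiv (fun _ : Fin N => i₀)))
  have hW := algBorderRank_subwords_le K a B a N _ hφ hr
  refine ⟨towerStep_of_le K _ _ _ (fun w => one_le_prod_word ha1 _) hW, fun s t hst => ?_⟩
  have h := virtualSum_le_algBorderRank K _ _ hst
    (fun w => two_le_prod_dropAnchor a ha1 ha2 hM w) (fun w => one_le_prod_word hB _) hW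
  exact_mod_cast h

end Summit.MatrixMultiplication.MatrixMultiplication.Theorems.FarEdgeDescentTowerStep

end
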